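import Summits.ValiantsHypothesis.ValiantsHypothesis.Theorems.KPlusLogSqLawTropicalExchange

/-!
# Route «KPlusLogSqLaw», crux `WeakLifting` (stmt-ValiantsHypothesis-19561), docket D2 — DISJOINT PATCHES STRADDLE THEIR BASE

HONEST FRAMING.  Helper file (cell `pub-symmetroid`, seat val-sym-lift-p3 g26, 2026-08-29) `--supports` the crux
`Summit.ValiantsHypothesis.ValiantsHypothesis.Theses.KPlusLogSqLaw.WeakLifting` (ledger item `stmt-ValiantsHypothesis-19561`, route `KPlusLogSqLaw`;
lineage docket D2, the count `Z` of «zero-fresh» = recombination steps of a dominant chain).  STRUCTURE law for dominant terms of an ARBITRARY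
dominance design (any format, exponents, valuations; no sign hypothesis); bounds no row; asserts nothing about `WeakLifting`, `TropicalB`,
`Lifting`, `KPlusLogSqLaw`, `MatrixDescartes` (stmt-ValiantsHypothesis-18050) or VP ≠ VNP.  No `def`.

THE LAW.  Call a term `r` a PATCH of a term `q` on the column set `C` if `r` carries the incidence (row, class) of `q` in every column outside `C`.
Let `r₁` be dominant at `θ₁` and `r₂` at `θ₂ > θ₁`, and let both be patches of one and the same term `q` (ANY term — `q` need not be dominant,
not even present as a whole) on DISJOINT column sets `C₁`, `C₂`, each nontrivial (`r_j ≠ q`).  Then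
  `slope r₁ < slope q < slope r₂`                                   (`slope_base_strictly_between`)
— the base lies strictly between its two disjoint patches; equivalently (`not_both_after`, `not_both_before`) a term is never the common base
of two disjoint nontrivial patches that are BOTH dominant LATER than a dominant occurrence of itself, nor both earlier; and two dominant patches
on the same side of their (dominant) base must OVERLAP (`patches_overlap_of_sameSide`).  PROOF: the component exchange law
`sum_lt_sum_of_swap` (tree, p439995) on the column set `C₁` — there `r₂` agrees with `q`, and `r₁`, `q` use the same rows of `C₁` as sets
because they are permutations agreeing off `C₁` (`image_eq_of_agree_off`) — gives `Σ_{C₁} d r₁ < Σ_{C₁} d r₂ = Σ_{C₁} d q`, i.e.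
`slope r₁ < slope q`; symmetrically on `C₂`.  (The tree's `ConvexPosition.parallelogram_free` is the four-DOMINANT-term version, with the joint
patch dominant as well; here only the two patches are dominant and the base is arbitrary.)
WHY IT IS RECORDED (located, HOME/val-sym-lift-p3/g26/memo §2(iv), §5): every one of the 1 033 zero-fresh steps of the kernel census chains is a
single-cycle PATCH on 2–4 columns of a term 1–3 positions back; the law says two such patches of the same recent term can never be disjoint
(36 653 428 same-side small-patch pairs in the census, 0 disjoint — as it must be), which is the mechanism behind the located multiplicity
«a term is the last supplier of ≤ 2 zero-fresh steps».  [folklore; corollary of the cited tree lemma]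
-/

set_option linter.dupNamespace false
set_option autoImplicit false

namespace Summit.ValiantsHypothesis.ValiantsHypothesis.Theorems.KPlusLogSqLaw

open Summit.ValiantsHypothesis.ValiantsHypothesis.Theorems.MatrixDescartes.Negative
open Summit.ValiantsHypothesis.ValiantsHypothesis.Theorems.LacunarySymmetroidMatrixDescartes.TropicalCensus
open scoped BigOperators
open Finset

namespace PatchStraddle

variable {m K : ℕ}

/-- two permutations that agree off `C` map `C` onto the same set. -/
theorem image_eq_of_agree_off (σ τ : Equiv.Perm (Fin m)) (C : Finset (Fin m))
    (h : ∀ i, i ∉ C → σ i = τ i) : C.image σ = C.image τ := by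
  classical
  -- one inclusion for any such pair, then symmetry
  have key : ∀ (σ τ : Equiv.Perm (Fin m)), (∀ i, i ∉ C → σ i = τ i) → C.image σ ⊆ C.image τ := by
    intro σ τ h x hx
    obtain ⟨i, hi, rfl⟩ := mem_image.mp hx
    by_cases hj : τ.symm (σ i) ∈ C
    · exact mem_image.mpr ⟨τ.symm (σ i), hj, by simp⟩
    · exfalso
      have h1 : σ (τ.symm (σ i)) = τ (τ.symm (σ i)) := h _ hj
      rw [Equiv.apply_symm_apply] at h1
      have h2 : τ.symm (σ i) = i := σ.injective h1
      exact hj (by rw [h2]; exact hi)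
  exact Subset.antisymm (key σ τ h) (key τ σ fun i hi => (h i hi).symm)

/-- the slope of a patch differs from the slope of its base only on the patched columns. -/
theorem slope_sub_slope_eq (d : Fin K → ℕ) (q r : Equiv.Perm (Fin m) × (Fin m → Fin K)) (C : Finset (Fin m))
    (h : ∀ i, i ∉ C → (r.1 i, r.2 i) = (q.1 i, q.2 i)) :
    slope d r - slope d q = ∑ i ∈ C, (d (r.2 i) : ℤ) - ∑ i ∈ C, (d (q.2 i) : ℤ) := by
  classical
  unfold LacunarySymmetroidMatrixDescartes.TropicalCensus.slope
  rw [← sum_sub_distrib, ← sum_sub_distrib]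
  symm
  refine sum_subset (subset_univ C) fun i _ hi => ?_
  have := (Prod.mk.inj (h i hi)).2
  rw [this, sub_self]

/-- **DISJOINT PATCHES STRADDLE THEIR BASE.**  `r₁` dominant at `θ₁ < θ₂`, `r₂` dominant at `θ₂`, both patches of a term `q` on disjoint column
sets `C₁`, `C₂`, both nontrivial ⇒ `slope r₁ < slope q < slope r₂`. -/
theorem slope_base_strictly_between (d : Fin K → ℕ) (v ε : Fin m → Fin m → Fin K → ℤ) {θ₁ θ₂ : ℤ} (h12 : θ₁ < θ₂)
    (q r₁ r₂ : Equiv.Perm (Fin m) × (Fin m → Fin K)) (h₁ : IsDominant d v ε θ₁ r₁) (h₂ : IsDominant d v ε θ₂ r₂)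
    (C₁ C₂ : Finset (Fin m)) (hdisj : Disjoint C₁ C₂)
    (hp₁ : ∀ i, i ∉ C₁ → (r₁.1 i, r₁.2 i) = (q.1 i, q.2 i)) (hp₂ : ∀ i, i ∉ C₂ → (r₂.1 i, r₂.2 i) = (q.1 i, q.2 i))
    (hne₁ : r₁ ≠ q) (hne₂ : r₂ ≠ q) :
    slope d r₁ < slope d q ∧ slope d q < slope d r₂ := by
  classical
  -- where each patch differs from the base
  have hdiff₁ : ∃ i ∈ C₁, (r₁.1 i, r₁.2 i) ≠ (q.1 i, q.2 i) := by
    by_contra hall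
    push Not at hall
    apply hne₁
    refine Prod.ext (Equiv.ext fun i => ?_) (funext fun i => ?_)
    · by_cases hi : i ∈ C₁
      · exact (Prod.mk.inj (hall i hi)).1
      · exact (Prod.mk.inj (hp₁ i hi)).1
    · by_cases hi : i ∈ C₁
      · exact (Prod.mk.inj (hall i hi)).2
      · exact (Prod.mk.inj (hp₁ i hi)).2
  have hdiff₂ : ∃ i ∈ C₂, (r₂.1 i, r₂.2 i) ≠ (q.1 i, q.2 i) := by
    by_contra hall
    push Not at hall
    apply hne₂
    refine Prod.ext (Equiv.ext fun i => ?_) (funext fun i => ?_)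
    · by_cases hi : i ∈ C₂
      · exact (Prod.mk.inj (hall i hi)).1
      · exact (Prod.mk.inj (hp₂ i hi)).1
    · by_cases hi : i ∈ C₂
      · exact (Prod.mk.inj (hall i hi)).2
      · exact (Prod.mk.inj (hp₂ i hi)).2
  -- on `C₁` the later patch agrees with the base, on `C₂` the earlier one does
  have hq₂ : ∀ i ∈ C₁, (r₂.1 i, r₂.2 i) = (q.1 i, q.2 i) :=
    fun i hi => hp₂ i (fun hi2 => disjoint_left.mp hdisj hi hi2)
  have hq₁ : ∀ i ∈ C₂, (r₁.1 i, r₁.2 i) = (q.1 i, q.2 i) :=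
    fun i hi => hp₁ i (fun hi1 => disjoint_left.mp hdisj hi1 hi)
  -- rows as sets agree on each patch set
  have himg₁ : C₁.image r₁.1 = C₁.image r₂.1 := by
    rw [image_eq_of_agree_off r₁.1 q.1 C₁ (fun i hi => (Prod.mk.inj (hp₁ i hi)).1)]
    exact image_congr fun i hi => ((Prod.mk.inj (hq₂ i (mem_coe.mp hi))).1).symm
  have himg₂ : C₂.image r₁.1 = C₂.image r₂.1 := by
    rw [image_congr (show Set.EqOn r₁.1 q.1 ↑C₂ from fun i hi => (Prod.mk.inj (hq₁ i (mem_coe.mp hi))).1)]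
    exact (image_eq_of_agree_off r₂.1 q.1 C₂ (fun i hi => (Prod.mk.inj (hp₂ i hi)).1)).symm
  -- the component exchange law on `C₁` and on `C₂`
  have hx₁ : ∃ i ∈ C₁, (r₁.1 i, r₁.2 i) ≠ (r₂.1 i, r₂.2 i) := by
    obtain ⟨i, hi, hne⟩ := hdiff₁
    exact ⟨i, hi, by rw [hq₂ i hi]; exact hne⟩
  have hx₂ : ∃ i ∈ C₂, (r₁.1 i, r₁.2 i) ≠ (r₂.1 i, r₂.2 i) := by
    obtain ⟨i, hi, hne⟩ := hdiff₂
    exact ⟨i, hi, by rw [hq₁ i hi]; exact fun h => hne h.symm⟩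
  have hlt₁ := sum_lt_sum_of_swap d v ε h12 h₁ h₂ C₁ himg₁ hx₁
  have hlt₂ := sum_lt_sum_of_swap d v ε h12 h₁ h₂ C₂ himg₂ hx₂
  -- rewrite the patch sums against the base
  have hs₂C₁ : ∑ i ∈ C₁, (d (r₂.2 i) : ℤ) = ∑ i ∈ C₁, (d (q.2 i) : ℤ) :=
    sum_congr rfl fun i hi => by rw [(Prod.mk.inj (hq₂ i hi)).2]
  have hs₁C₂ : ∑ i ∈ C₂, (d (r₁.2 i) : ℤ) = ∑ i ∈ C₂, (d (q.2 i) : ℤ) :=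
    sum_congr rfl fun i hi => by rw [(Prod.mk.inj (hq₁ i hi)).2]
  have e₁ := slope_sub_slope_eq d q r₁ C₁ hp₁
  have e₂ := slope_sub_slope_eq d q r₂ C₂ hp₂
  rw [hs₂C₁] at hlt₁
  rw [hs₁C₂] at hlt₂
  constructor <;> linarith

/-- **Two disjoint nontrivial patches of a dominant term are never both dominant LATER than it.** -/
theorem not_both_after (d : Fin K → ℕ) (v ε : Fin m → Fin m → Fin K → ℤ) {θq θ₁ θ₂ : ℤ} (hq1 : θq < θ₁) (h12 : θ₁ < θ₂)
    (q r₁ r₂ : Equiv.Perm (Fin m) × (Fin m → Fin K)) (hq : IsDominant d v ε θq q)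
    (h₁ : IsDominant d v ε θ₁ r₁) (h₂ : IsDominant d v ε θ₂ r₂)
    (C₁ C₂ : Finset (Fin m)) (hdisj : Disjoint C₁ C₂)
    (hp₁ : ∀ i, i ∉ C₁ → (r₁.1 i, r₁.2 i) = (q.1 i, q.2 i)) (hp₂ : ∀ i, i ∉ C₂ → (r₂.1 i, r₂.2 i) = (q.1 i, q.2 i))
    (hne₁ : r₁ ≠ q) (hne₂ : r₂ ≠ q) : False := by
  have h := (slope_base_strictly_between d v ε h12 q r₁ r₂ h₁ h₂ C₁ C₂ hdisj hp₁ hp₂ hne₁ hne₂).1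
  have h' := slope_lt_of_dominant d v ε hq1 (Ne.symm hne₁) hq h₁
  exact absurd h (not_lt.mpr (le_of_lt h'))

/-- **… nor both dominant EARLIER than it.** -/
theorem not_both_before (d : Fin K → ℕ) (v ε : Fin m → Fin m → Fin K → ℤ) {θq θ₁ θ₂ : ℤ} (h12 : θ₁ < θ₂) (h2q : θ₂ < θq)
    (q r₁ r₂ : Equiv.Perm (Fin m) × (Fin m → Fin K)) (hq : IsDominant d v ε θq q)
    (h₁ : IsDominant d v ε θ₁ r₁) (h₂ : IsDominant d v ε θ₂ r₂)
    (C₁ C₂ : Finset (Fin m)) (hdisj : Disjoint C₁ C₂)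
    (hp₁ : ∀ i, i ∉ C₁ → (r₁.1 i, r₁.2 i) = (q.1 i, q.2 i)) (hp₂ : ∀ i, i ∉ C₂ → (r₂.1 i, r₂.2 i) = (q.1 i, q.2 i))
    (hne₁ : r₁ ≠ q) (hne₂ : r₂ ≠ q) : False := by
  have h := (slope_base_strictly_between d v ε h12 q r₁ r₂ h₁ h₂ C₁ C₂ hdisj hp₁ hp₂ hne₁ hne₂).2
  have h' := slope_lt_of_dominant d v ε h2q hne₂ h₂ hq
  exact absurd h (not_lt.mpr (le_of_lt h'))

/-- **Chain form: two dominant patches on the same side of their dominant base OVERLAP.**  Along terms `p r` dominant at strictly increasing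
`θ r`: if `p x` and `p y` (`x < y`) are nontrivial patches of `p c` on column sets `Cx`, `Cy`, and `c < x` or `y < c`, then `Cx ∩ Cy ≠ ∅`. -/
theorem patches_overlap_of_sameSide {n : ℕ} (d : Fin K → ℕ) (v ε : Fin m → Fin m → Fin K → ℤ)
    (θ : Fin (n + 1) → ℤ) (hθ : StrictMono θ) (p : Fin (n + 1) → Equiv.Perm (Fin m) × (Fin m → Fin K))
    (hdom : ∀ r, IsDominant d v ε (θ r) (p r)) {c x y : Fin (n + 1)} (hxy : x < y) (hside : c < x ∨ y < c)
    (Cx Cy : Finset (Fin m))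
    (hpx : ∀ i, i ∉ Cx → ((p x).1 i, (p x).2 i) = ((p c).1 i, (p c).2 i))
    (hpy : ∀ i, i ∉ Cy → ((p y).1 i, (p y).2 i) = ((p c).1 i, (p c).2 i))
    (hnex : p x ≠ p c) (hney : p y ≠ p c) : ¬ Disjoint Cx Cy := by
  intro hdisj
  rcases hside with hcx | hyc
  · exact not_both_after d v ε (hθ hcx) (hθ hxy) (p c) (p x) (p y) (hdom c) (hdom x) (hdom y) Cx Cy hdisj hpx hpy hnex hney
  · exact not_both_before d v ε (hθ hxy) (hθ hyc) (p c) (p x) (p y) (hdom c) (hdom x) (hdom y) Cx Cy hdisj hpx hpy hnex hney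

end PatchStraddle

end Summit.ValiantsHypothesis.ValiantsHypothesis.Theorems.KPlusLogSqLaw
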